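import Summits.ABC.IUTFork.Thm311RealInd1StripTwistJW
import Summits.ABC.IUTFork.Thm311RealInd1StripTraceRigid
import HarnessLib

/-!
# [IUTchIII] Thm 3.11 (i) (Ind1) at `v ∈ 𝕍^non`, ODD local degree: the Jannsen–Wingberg basis `y_1; (y_{2i}, y_{2i+1})_i` of `K_v^{(1/n_v)}`
# with ALL plane transvections REALISED in print's (Ind1) strip part, and its trace data (modulo `JannsenWingbergTwists`)

PROOF-ONLY file (abc-iut cell, Cor. 3.12 sub-crew, seat abc-iut-c312-1 = holder of record of the typed [IUTchIII] Thm. 3.11,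
gen 13; row «R15 ODD-DEGREE BASE LINE», part a).  TAKES NO SIDE on [IUTchIII] Cor. 3.12.

The odd-degree twin of gen 12's `Thm311RealInd1StripTwistJWFirstPlanes` §1–§3 (p502329, even degree).  K. Kondo, arXiv:2512.09231,
proof of Thm. 2.3 p. 10: for `d_k` odd, `g := (d_k − 1)/2`, `a_i := x_{2i}`, `b_i := x_{2i+1}` (`1 ≤ i ≤ g`) and the twists `φ_i(b_i) = b_i a_i`,
`φ'_i(a_i) = a_i b_i⁻¹`; Thm. 2.3: «`Ker(Tr_{k/ℚ_p}) = ⟨y_2, y_3, …, y_{d_k}⟩_{ℚ_p}` (`d_k` odd)».  Gen 11 PROVED the `k_+`-action of the twists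
from the GROUP-level named fact `JannsenWingbergTwists` (`dehnTwists_closureAt_of_jannsenWingberg`, p493323: ONE basis `Fin c ⊕ Fin g × Fin 2`,
`c ≤ 2`) and packaged the planes WITHOUT the residual vector (`Thm311RealInd1StripTwistJWPlanes`, `…TwistKerTrace` p497143).  For the
base-line question at odd degree (part b, `Thm311RealInd1StripBaseLineOdd`) the residual vector `y_1` must be kept:
* `Real.exists_realised_basis_of_jannsenWingberg_odd` — at `v ∣ p` odd with `d = [K_v : ℚ_p] ≥ 3` ODD: `g` with `d = 1 + 2g` (`c = 1` is forced
  by parity), a `ℚ_p`-basis `y : Fin 1 ⊕ Fin g × Fin 2` of `K_v^{(1/n_v)}` (abc-iut-S7's rescaled completion) and `ψ i, ψ' i ∈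
  Real.ind1StripOf v (Real.galoisLog v)` acting as `x ↦ x + y^*_{(i,1)}(x)·y_{(i,0)}`, `x ↦ x − y^*_{(i,0)}(x)·y_{(i,1)}`;
* **`Real.exists_realised_basis_trace_of_jannsenWingberg_odd`** — moreover every plane vector is trace-zero (trace rigidity of print's (Ind1)
  strip part, gen 11 `trace_apply_eq_of_mem_ind1StripOf` = Hoshi–Nishio Lem. 2.3 (ii)), `span_{ℚ_p}(planes) = Ker(Tr_{K_v/ℚ_p})` (Kondo Thm. 2.3,
  odd case, by the dimension count `2g = d − 1`), and `Tr(y_{inl 0}) ≠ 0`.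
HONEST SCOPE: conditional on `hJW : JannsenWingbergTwists` (Jannsen–Wingberg 1982 / NSW 7.5.14 / Hoshi–Nishio 2022, with Kondo's 2025
all-planes reading, flag (α)) displayed as a binder; statements about OUR typed objects at ONE place; nothing here asserts or refutes
[IUTchIII] Cor. 3.12; NO abc claim.  [claim: Mochizuki2012, status: disputed]; [cite: Kondo2025OuterAutMLF, §2 Thm 2.1, Thm 2.3 and proof
p.10]; [cite: HoshiNishio2022OuterAutMLF, Prop 1.1, Lemma 1.3, Lemma 2.3 (ii)]; [cite: JannsenWingberg1982, Thm 2 p.75 and §5.1 p.96];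
[cite: DupuyHilado2025, §4.7].  typed ≠ proved; a conditional theorem discharges nothing it binds.
-/


set_option autoImplicit false

noncomputable section

open Metric Set
open scoped Pointwise

namespace Summit.ABC.IUTFork.Thm311.Real

open NumberField IsDedekindDomain Literature.NumberTheory.NumberFields Literature.IUT.LogVolume
open Literature.NumberTheory.GaloisRepresentations
open Literature.AnabelianGeometry.AbsoluteAnabelian Literature.IUT.HodgeArakelov
open Literature.IUT.HodgeArakelov.AbsTopMonoids

variable {F : Type} [Field F] [NumberField F] (v : HeightOneSpectrum (𝓞 F))

/-! ## 1. Odd degree: the Jannsen–Wingberg basis (`c = 1`) with the plane transvections realised -/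

/-- **The Jannsen–Wingberg basis with ALL plane transvections REALISED in print's (Ind1) strip part — ODD local degree.**  Assume
`JannsenWingbergTwists`.  At a finite place `v ∣ p` of `F` with `p` odd and `d = [K_v : ℚ_p] ≥ 3` ODD there are `g` with `d = 1 + 2g`,
a `ℚ_p`-basis `y` of `K_v^{(1/n_v)}` (abc-iut-S7's rescaled completion) indexed by `Fin 1 ⊕ Fin g × Fin 2` — Kondo's `y_1` and the planes
`(a_i, b_i) = (y_{2i}, y_{2i+1})` — and `ψ i, ψ' i ∈ Real.ind1StripOf v (Real.galoisLog v)` acting as `x ↦ x + y^*_{(i,1)}(x)·y_{(i,0)}` and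
`x ↦ x − y^*_{(i,0)}(x)·y_{(i,1)}` (gen 11's `dehnTwists_closureAt_of_jannsenWingberg`: `c ≤ 2`, `d = c + 2g`, so `c = 1` for odd `d`).
[claim: Mochizuki2012, status: disputed] [cite: Kondo2025OuterAutMLF, §2 Thm 2.1 and proof of Thm 2.3 p.10]
[cite: JannsenWingberg1982, §5.1 p.96] -/
theorem exists_realised_basis_of_jannsenWingberg_odd (hJW : JannsenWingbergTwists)
    (p : ℕ) [Fact p.Prime] (hv : ((p : ℕ) : 𝓞 F) ∈ v.asIdeal) (hp2 : p ≠ 2) (h3 : 3 ≤ localDeg F v) (hodd : Odd (localDeg F v)) :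
    ∃ (g : ℕ) (_ : localDeg F v = 1 + 2 * g) (y : Module.Basis (Fin 1 ⊕ Fin g × Fin 2) ℚ_[p] (RescaledCompletion F p v hv))
      (ψ ψ' : Fin g → (v.adicCompletion F ≃+ v.adicCompletion F)),
      (∀ i, ψ i ∈ ind1StripOf v (galoisLog v)) ∧ (∀ i, ψ' i ∈ ind1StripOf v (galoisLog v)) ∧
      (∀ i (x : RescaledCompletion F p v hv),
        RescaledCompletion.of F p v hv (ψ i ((RescaledCompletion.of F p v hv).symm x)) =
          x + y.coord (Sum.inr (i, 1)) x • y (Sum.inr (i, 0))) ∧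
      (∀ i (x : RescaledCompletion F p v hv),
        RescaledCompletion.of F p v hv (ψ' i ((RescaledCompletion.of F p v hv).symm x)) =
          x - y.coord (Sum.inr (i, 0)) x • y (Sum.inr (i, 1))) := by
  -- `p` IS the residue characteristic of `K_v`
  obtain rfl : p = (closureAt v).residueChar := eq_residueChar_closureAt_of_natCast_mem v hv
  have hpk : ValuativeRel.valuation (v.adicCompletion F) (closureAt v).residueChar < 1 :=
    LocalField.valuation_adicCompletion_natCast_lt_one v (closureAt v).residueChar hv
  haveI : CharZero (closureAt v).k := (closureAt v).instChar
  letI iQ : Algebra ℚ_[(closureAt v).residueChar] (closureAt v).k :=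
    LocalField.padicAlgebra (closureAt v).k (closureAt v).residueChar hpk
  have hlocal : localDeg F v = Module.finrank ℚ_[(closureAt v).residueChar] (closureAt v).k := by
    exact RescaledCompletion.localDeg_eq_finrank F (closureAt v).residueChar v hv
  have hfin : 3 ≤ Module.finrank ℚ_[(closureAt v).residueChar] (closureAt v).k := by rw [← hlocal]; exact h3
  -- gen 11: ONE basis `Fin c ⊕ Fin g × Fin 2`, `c ≤ 2`, all planes realised through THE equivariant lift
  obtain ⟨c, g, hc, y, hplanes⟩ := dehnTwists_closureAt_of_jannsenWingberg v hJW hpk hp2 hfin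
  have hcard : localDeg F v = c + 2 * g := by
    rw [hlocal, Module.finrank_eq_card_basis y, Fintype.card_sum, Fintype.card_prod, Fintype.card_fin, Fintype.card_fin,
      Fintype.card_fin]
    omega
  -- `d = c + 2g` odd with `c ≤ 2` forces `c = 1`
  have hc1 : c = 1 := by obtain ⟨m, hm⟩ := hodd; omega
  subst hc1
  have h1 := fun i => (hplanes i).1
  have h1' := fun i => (hplanes i).2
  choose φ hφ using h1
  choose φ' hφ' using h1'
  -- the module topology of `K_v` over `ℚ_p`: linear maps are continuous
  haveI : ContinuousSMul ℚ_[(closureAt v).residueChar] (closureAt v).k :=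
    continuousSMul_of_algebraMap ℚ_[(closureAt v).residueChar] _
      (by exact LocalField.continuous_algebraMap_adicCompletionPadicAlgebra v (closureAt v).residueChar hv)
  haveI : FiniteDimensional ℚ_[(closureAt v).residueChar] (closureAt v).k :=
    Module.finite_of_finrank_pos (by omega)
  -- a transvection `x ↦ x + c(x)•a` with `c a = 0` as a linear automorphism
  have hcoord : ∀ s t : Fin 1 ⊕ Fin g × Fin 2, y.coord s (y t) = if t = s then 1 else 0 := by
    intro s t
    rw [Module.Basis.coord_apply, Module.Basis.repr_self, Finsupp.single_apply]
  let tv : ∀ (s t : Fin 1 ⊕ Fin g × Fin 2), s ≠ t → ((closureAt v).k ≃ₗ[ℚ_[(closureAt v).residueChar]] (closureAt v).k) :=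
    fun s t hst =>
    LinearEquiv.ofLinear
      (LinearMap.id + (y.coord t).smulRight (y s))
      (LinearMap.id - (y.coord t).smulRight (y s))
      (by
        apply LinearMap.ext; intro x
        simp [hst])
      (by
        apply LinearMap.ext; intro x
        simp [hst])
  have htv : ∀ s t hst x, tv s t hst x = x + y.coord t x • y s := fun s t hst x => rfl
  have htv_sub : ∀ s t hst x, (tv s t hst).symm x = x - y.coord t x • y s := fun s t hst x => rfl
  -- membership in print's (Ind1) strip part over the Galois logarithm
  have hneab : ∀ i : Fin g, (Sum.inr (i, 0) : Fin 1 ⊕ Fin g × Fin 2) ≠ Sum.inr (i, 1) := fun i => by simp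
  have hneba : ∀ i : Fin g, (Sum.inr (i, 1) : Fin 1 ⊕ Fin g × Fin 2) ≠ Sum.inr (i, 0) := fun i => by simp
  have hψ : ∀ i, (tv _ _ (hneab i)).toAddEquiv ∈ ind1StripOf v (galoisLog v) := fun i =>
    ⟨by exact (tv _ _ (hneab i)).toLinearMap.continuous_of_finiteDimensional,
      by exact (tv _ _ (hneab i)).symm.toLinearMap.continuous_of_finiteDimensional, φ i,
      realises_galoisLog_of_liftActsOnUnitLogAs v hpk (φ i) _ (hφ i) (tv _ _ (hneab i)).toAddEquiv (htv _ _ (hneab i))⟩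
  have hψ' : ∀ i, (tv _ _ (hneba i)).symm.toAddEquiv ∈ ind1StripOf v (galoisLog v) := fun i =>
    ⟨by exact (tv _ _ (hneba i)).symm.toLinearMap.continuous_of_finiteDimensional,
      by exact (tv _ _ (hneba i)).toLinearMap.continuous_of_finiteDimensional, φ' i,
      realises_galoisLog_of_liftActsOnUnitLogAs v hpk (φ' i) _ (hφ' i) (tv _ _ (hneba i)).symm.toAddEquiv
        (htv_sub _ _ (hneba i))⟩
  -- transport to the rescaled norm (`of` is the identity of `K_v`, `ℚ_p`-linear)
  let e := RescaledCompletion.of F (closureAt v).residueChar v hv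
  let eL : (closureAt v).k ≃ₗ[ℚ_[(closureAt v).residueChar]] RescaledCompletion F (closureAt v).residueChar v hv :=
    { e.toAddEquiv with
      map_smul' := fun c x => by
        change e (c • x) = c • e x
        rw [Algebra.smul_def, Algebra.smul_def, map_mul]
        rfl }
  have heL : ∀ x, eL x = e x := fun x => rfl
  have heLs : ∀ x, eL.symm x = e.symm x := fun x => rfl
  let yR : Module.Basis (Fin 1 ⊕ Fin g × Fin 2) ℚ_[(closureAt v).residueChar]
      (RescaledCompletion F (closureAt v).residueChar v hv) := y.map eL
  have hyR : ∀ s, yR s = eL (y s) := fun s => Module.Basis.map_apply y eL s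
  have hyRc : ∀ s x, yR.coord s x = y.coord s (eL.symm x) := by
    intro s x
    change (y.map eL).repr x s = y.repr (eL.symm x) s
    rw [Module.Basis.map_repr, LinearEquiv.trans_apply]
  refine ⟨g, by omega, yR, fun i => (tv _ _ (hneab i)).toAddEquiv, fun i => (tv _ _ (hneba i)).symm.toAddEquiv, hψ, hψ', ?_, ?_⟩
  · intro i x
    change e (tv _ _ (hneab i) (e.symm x)) = x + yR.coord (Sum.inr (i, 1)) x • yR (Sum.inr (i, 0))
    rw [htv _ _ (hneab i), map_add, RingEquiv.apply_symm_apply, hyRc, hyR, ← heL, ← heLs, map_smul]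
  · intro i x
    change e ((tv _ _ (hneba i)).symm (e.symm x)) = x - yR.coord (Sum.inr (i, 0)) x • yR (Sum.inr (i, 1))
    rw [htv_sub _ _ (hneba i), map_sub, RingEquiv.apply_symm_apply, hyRc, hyR, ← heL, ← heLs, map_smul]

/-! ## 2. Trace rigidity: the planes span `Ker(Tr)`, the residual vector is not trace-zero -/

/-- **The odd-degree basis WITH its trace data**: the data of `exists_realised_basis_of_jannsenWingberg_odd` and, IN ADDITION, every plane
vector is trace-zero (trace rigidity of print's (Ind1) strip part, gen 11 `trace_apply_eq_of_mem_ind1StripOf` — Hoshi–Nishio Lem. 2.3 (ii):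
`Tr(y_b + y_a) = Tr(ψ y_b) = Tr(y_b)`), `span_{ℚ_p}(planes) = Ker(Tr_{K_v/ℚ_p})` — Kondo's Thm. 2.3, odd case «`Ker(Tr_{k/ℚ_p}) =
⟨y_2, y_3, …, y_{d_k}⟩`» (dimension count `2g = d − 1`, `Tr 1 = d ≠ 0`) —, and `Tr(y_{inl 0}) ≠ 0` (else `Tr = 0`).
[claim: Mochizuki2012, status: disputed] [cite: Kondo2025OuterAutMLF, §2 Thm 2.3 p.9] [cite: HoshiNishio2022OuterAutMLF, Lemma 2.3 (ii) p.7] -/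
theorem exists_realised_basis_trace_of_jannsenWingberg_odd (hJW : JannsenWingbergTwists)
    (p : ℕ) [Fact p.Prime] (hv : ((p : ℕ) : 𝓞 F) ∈ v.asIdeal) (hp2 : p ≠ 2) (h3 : 3 ≤ localDeg F v) (hodd : Odd (localDeg F v)) :
    ∃ (g : ℕ) (_ : localDeg F v = 1 + 2 * g) (y : Module.Basis (Fin 1 ⊕ Fin g × Fin 2) ℚ_[p] (RescaledCompletion F p v hv))
      (ψ ψ' : Fin g → (v.adicCompletion F ≃+ v.adicCompletion F)),
      (∀ i, ψ i ∈ ind1StripOf v (galoisLog v)) ∧ (∀ i, ψ' i ∈ ind1StripOf v (galoisLog v)) ∧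
      (∀ i (x : RescaledCompletion F p v hv),
        RescaledCompletion.of F p v hv (ψ i ((RescaledCompletion.of F p v hv).symm x)) =
          x + y.coord (Sum.inr (i, 1)) x • y (Sum.inr (i, 0))) ∧
      (∀ i (x : RescaledCompletion F p v hv),
        RescaledCompletion.of F p v hv (ψ' i ((RescaledCompletion.of F p v hv).symm x)) =
          x - y.coord (Sum.inr (i, 0)) x • y (Sum.inr (i, 1))) ∧
      (∀ iε : Fin g × Fin 2, Algebra.trace ℚ_[p] (RescaledCompletion F p v hv) (y (Sum.inr iε)) = 0) ∧
      Submodule.span ℚ_[p] (Set.range fun iε : Fin g × Fin 2 => y (Sum.inr iε)) =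
        LinearMap.ker (Algebra.trace ℚ_[p] (RescaledCompletion F p v hv)) ∧
      Algebra.trace ℚ_[p] (RescaledCompletion F p v hv) (y (Sum.inl 0)) ≠ 0 := by
  obtain rfl : p = (closureAt v).residueChar := eq_residueChar_closureAt_of_natCast_mem v hv
  obtain ⟨g, hcard, y, ψ, ψ', hψ, hψ', hT, hT'⟩ := exists_realised_basis_of_jannsenWingberg_odd v hJW (closureAt v).residueChar hv hp2 h3 hodd
  haveI : FiniteDimensional ℚ_[(closureAt v).residueChar] (RescaledCompletion F (closureAt v).residueChar v hv) :=
    FiniteDimensional.of_locallyCompactSpace ℚ_[(closureAt v).residueChar]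
  set Tr := Algebra.trace ℚ_[(closureAt v).residueChar] (RescaledCompletion F (closureAt v).residueChar v hv) with hTr
  have hfin : Module.finrank ℚ_[(closureAt v).residueChar] (RescaledCompletion F (closureAt v).residueChar v hv) = localDeg F v :=
    (RescaledCompletion.localDeg_eq_finrank F (closureAt v).residueChar v hv).symm
  have hcoord : ∀ s t : Fin 1 ⊕ Fin g × Fin 2, y.coord s (y t) = if t = s then 1 else 0 := by
    intro s t
    rw [Module.Basis.coord_apply, Module.Basis.repr_self, Finsupp.single_apply]
  -- the plane vectors are trace-zero
  have htp : ∀ iε : Fin g × Fin 2, Tr (y (Sum.inr iε)) = 0 := by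
    rintro ⟨i, ε⟩
    fin_cases ε
    · -- `Tr(y_b + y_a) = Tr(y_b)`
      have h := trace_apply_eq_of_mem_ind1StripOf v (hψ i)
        ((RescaledCompletion.of F (closureAt v).residueChar v hv).symm (y (Sum.inr (i, 1))))
      rw [hT i, RingEquiv.apply_symm_apply, hcoord, if_pos rfl, one_smul, map_add, add_eq_left] at h
      exact h
    · -- `Tr(y_a − y_b) = Tr(y_a)`
      have h := trace_apply_eq_of_mem_ind1StripOf v (hψ' i)
        ((RescaledCompletion.of F (closureAt v).residueChar v hv).symm (y (Sum.inr (i, 0))))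
      rw [hT' i, RingEquiv.apply_symm_apply, hcoord, if_pos rfl, one_smul, map_sub, sub_eq_self] at h
      exact h
  -- `⊆`
  have hle : Submodule.span ℚ_[(closureAt v).residueChar] (Set.range fun iε : Fin g × Fin 2 => y (Sum.inr iε)) ≤ LinearMap.ker Tr := by
    rw [Submodule.span_le]
    rintro _ ⟨a, rfl⟩
    exact (LinearMap.mem_ker).mpr (htp a)
  -- the span has dimension `2g`
  have hli : LinearIndependent ℚ_[(closureAt v).residueChar] (fun iε : Fin g × Fin 2 => y (Sum.inr iε)) :=
    y.linearIndependent.comp Sum.inr Sum.inr_injective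
  have hspan : Module.finrank ℚ_[(closureAt v).residueChar]
      (Submodule.span ℚ_[(closureAt v).residueChar] (Set.range fun iε : Fin g × Fin 2 => y (Sum.inr iε))) = 2 * g := by
    rw [finrank_span_eq_card hli, Fintype.card_prod, Fintype.card_fin, Fintype.card_fin]
    ring
  -- `Tr` is onto `ℚ_p` (`Tr 1 = d ≠ 0`), so `dim Ker(Tr) = d − 1 = 2g`
  have hTr1 : Tr 1 ≠ 0 := by
    rw [hTr, ← map_one (algebraMap ℚ_[(closureAt v).residueChar] (RescaledCompletion F (closureAt v).residueChar v hv)),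
      Algebra.trace_algebraMap, hfin, nsmul_eq_mul, mul_one]
    exact_mod_cast (show localDeg F v ≠ 0 by omega)
  have hrangeTr : LinearMap.range Tr = ⊤ := by
    rw [eq_top_iff]
    intro t _
    refine ⟨(t / Tr 1) • (1 : RescaledCompletion F (closureAt v).residueChar v hv), ?_⟩
    rw [map_smul, smul_eq_mul, div_mul_cancel₀ t hTr1]
  have hker : Module.finrank ℚ_[(closureAt v).residueChar] (LinearMap.ker Tr) = 2 * g := by
    have h := LinearMap.finrank_range_add_finrank_ker Tr
    rw [hrangeTr, finrank_top, Module.finrank_self, hfin, hcard] at h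
    omega
  have heq : Submodule.span ℚ_[(closureAt v).residueChar] (Set.range fun iε : Fin g × Fin 2 => y (Sum.inr iε)) = LinearMap.ker Tr :=
    Submodule.eq_of_le_of_finrank_eq hle (by rw [hspan, hker])
  refine ⟨g, hcard, y, ψ, ψ', hψ, hψ', hT, hT', htp, heq, fun h0 => hTr1 ?_⟩
  -- if also `Tr(y_{inl 0}) = 0`, every basis vector is trace-zero, so `Tr = 0`
  have hall : ∀ s, Tr (y s) = 0 := by
    rintro (t | a)
    · fin_cases t
      exact h0
    · exact htp a
  have hzero : Tr = 0 := y.ext fun s => by rw [hall s, LinearMap.zero_apply]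
  rw [hzero, LinearMap.zero_apply]

end Summit.ABC.IUTFork.Thm311.Real

end
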